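import Literature.Geometry.Kaehler.SiegelTorusThetaDivisorDiagonal
import Literature.Geometry.Kaehler.SiegelTorusThetaParity
import HarnessLib

/-!
# Theta-nulls and two-division points on `Θ` for a product of elliptic curves: exactly `4ⁿ − 3ⁿ`

Layer `Literature/Geometry/Kaehler`, namespace `Literature.Geometry.Kaehler.ComplexTorus` (lane
`lit-hodgefound`, Layer A4, theta-divisor row A4-17, validation instance "products of elliptic curves";
prover seat `lit-hodgefound-p23`). Sequel of `SiegelTorusThetaDivisorDiagonal.lean` (for
`Ω = diag(τ₁, …, τₙ)`: `Θ = ⋃ᵢ {x ∣ x(inl i) = x(inr i) = ½}`) and `SiegelTorusThetaParity.lean` (the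
two-division points `π(½m)`, `X₂ ≃ (ℤ/2ℤ)^{2n}`, parity; `Θ ⊇` the `2^{n-1}(2ⁿ − 1)` odd points, with the
remark that equality fails for special `Ω`). Here the special case `Ω = diag(τ)` is computed exactly.

Source followed: H. Farkas, S. Grushevsky, R. Salvati Manni, *An explicit solution to the weak Schottky
problem*, Algebr. Geom. 8 (2021), §4 [held `paper:arxiv-1710.02938` p0011]: "the theta constant of a
diagonal period matrix decomposes as a product `θ[ε;δ](diag(t₁, …, t_g)) = θ[ε₁;δ₁](t₁)·…·θ[ε_g;δ_g](t_g)`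
… Note that if no column `[εₘ; δₘ]` is equal to `[1;1]`, then the Taylor series have a non-zero constant
term … If precisely two different columns … are equal to `[1;1]`, then the Taylor series has zero constant
term", with §2 [p0006] "A characteristic is called even or odd depending on whether `εᵗ·δ ∈ ℤ/2ℤ` is
equal to `0` or `1` … All theta constants with odd characteristics vanish identically"; and S. Grushevsky,
*The Schottky problem* (2012), §5 [held `paper:arxiv-1009.0369` p0011]:
"`θ_null,g = {(A, Θ) ∈ 𝒜_g ∣ A[2]^even ∩ Θ ≠ ∅}`".

What is proved (theorems only; no definition, no named fact, net debt `0`), for `Ω = diag(τ)`,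
`Im τᵢ > 0`, on the principally polarised Siegel torus `X = E_{τ₁} × ⋯ × E_{τₙ}`:

* **`riemannThetaChar_half_diagonal_zero_eq_zero_iff`** — for `k, l ∈ ℤⁿ`:
  `ϑ[k/2; l/2](0, diag τ) = 0 ↔ ∃ i, kᵢ odd ∧ lᵢ odd` ("non-zero constant term iff no column is
  `[1;1]`"): exactly `4ⁿ − 3ⁿ` of the `4ⁿ` half-integer characteristics (mod `2`) have a vanishing
  theta-null, the `2^{n-1}(2ⁿ − 1)` odd ones and `4ⁿ − 3ⁿ − 2^{n-1}(2ⁿ − 1)` EVEN ones (`n ≥ 2`).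
* **`coe_mem_thetaDivisor_diagonal_iff`** — a two-division point `x ∈ X₂` lies on `Θ` iff its image
  `p ∈ (ℤ/2ℤ)^{2n}` under `X₂ ≃ (ℤ/2ℤ)^{2n}` (`divisionPointsEquiv`) has a column `(p(inl i), p(inr i)) = (1, 1)`;
* **`natCard_twoTorsion_inter_thetaDivisor_diagonal`** — `#(X₂ ∩ Θ) = 4ⁿ − 3ⁿ` (complement: `3` admissible
  values per column); `natCard_twoTorsion_inter_thetaDivisor_diagonal_fin_two` — `E_{τ₁} × E_{τ₂}`:
  exactly `7` of the `16` two-division points lie on `Θ = E₁ × {p₂} ∪ {p₁} × E₂` (the `6` odd ones and the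
  node `(p₁, p₂)`).

## References

* [FarkasGrushevskySalvatimanni2021] H. Farkas, S. Grushevsky, R. Salvati Manni, An explicit solution to the
  weak Schottky problem, Algebr. Geom. 8 (2021), §2, §4 (arXiv p. 11).
* [Grushevsky2012SchottkyProblem] S. Grushevsky, The Schottky problem, MSRI Publ. 59 (2012), §5.
* [Lange2023AbelianVarietiesComplex] H. Lange, Abelian Varieties over the Complex Numbers (2023), §2.1.4
  Exercise (7), §2.3.4 Prop. 2.3.14.
-/

noncomputable section

open scoped Manifold Topology
open Set Function Complex Matrix
open Literature.Analysis.SpecialFunctions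

namespace Literature.Geometry.Kaehler

namespace ComplexTorus

/-! ### Theta-nulls of a diagonal period matrix: `ϑ[k/2; l/2](0, diag τ) = 0 ↔` some column is `[1;1]` -/

section ThetaNull

variable {n : ℕ} (τ : Fin n → ℂ) (hτ : ∀ i, 0 < (τ i).im)

include hτ in
/-- **The theta-nulls of `E_{τ₁} × ⋯ × E_{τₙ}`**: for integer vectors `k, l`,
`ϑ[k/2; l/2](0, diag τ) = 0 ↔ ∃ i, kᵢ odd ∧ lᵢ odd` — the theta constant is (up to an exponential)
`ϑ(½(τk + l), diag τ) = ∏ᵢ ϑ(½(τᵢkᵢ + lᵢ), τᵢ)`, and the `i`-th factor vanishes iff `½(τᵢkᵢ + lᵢ)` is a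
lattice translate of `½(1 + τᵢ)`, i.e. iff the column `[kᵢ; lᵢ]` is `[1;1]` mod `2` ("if no column
`[εₘ;δₘ]` is equal to `[1;1]`, then … non-zero constant term"; "all theta constants with odd characteristics
vanish" is the case of an odd number of such columns).
[cite: FarkasGrushevskySalvatimanni2021, §4 (arXiv p. 11) and §2 (p. 6)] -/
theorem riemannThetaChar_half_diagonal_zero_eq_zero_iff (k l : Fin n → ℤ) :
    riemannThetaChar (fun i ↦ (k i : ℂ) / 2) (fun i ↦ (l i : ℂ) / 2) (Matrix.diagonal τ) 0 = 0 ↔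
      ∃ i, Odd (k i) ∧ Odd (l i) := by
  rw [riemannThetaChar_eq_cexp_mul_riemannTheta (Matrix.diagonal τ) (diagonal_symm τ), mul_eq_zero,
    or_iff_right (Complex.exp_ne_zero _), zero_add, riemannTheta_diagonal_eq_zero_iff τ hτ]
  -- `1, τᵢ` are `ℝ`-independent
  have sep : ∀ i, ∀ a b c d : ℝ, (a : ℂ) + τ i * (b : ℂ) = (c : ℂ) + τ i * (d : ℂ) → a = c ∧ b = d := by
    intro i a b c d h
    have hre := congrArg Complex.re h
    have him := congrArg Complex.im h
    simp only [Complex.add_re, Complex.add_im, Complex.mul_re, Complex.mul_im, Complex.ofReal_re,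
      Complex.ofReal_im, mul_zero, sub_zero, zero_add] at hre him
    have hbd : b = d := mul_left_cancel₀ (hτ i).ne' him
    subst hbd
    exact ⟨by linarith, rfl⟩
  refine exists_congr fun i ↦ ?_
  have hcoord : (Matrix.diagonal τ *ᵥ (fun j ↦ (k j : ℂ) / 2) + fun j ↦ (l j : ℂ) / 2) i =
      (((l i : ℝ) / 2 : ℝ) : ℂ) + τ i * (((k i : ℝ) / 2 : ℝ) : ℂ) := by
    simp only [Pi.add_apply, Matrix.mulVec_diagonal]
    push_cast
    ring
  rw [hcoord]
  constructor
  · rintro ⟨m, m', h⟩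
    have h' : (((l i : ℝ) / 2 : ℝ) : ℂ) + τ i * (((k i : ℝ) / 2 : ℝ) : ℂ) =
        (((1 : ℝ) / 2 + m : ℝ) : ℂ) + τ i * (((1 : ℝ) / 2 + m' : ℝ) : ℂ) := by
      rw [h]; push_cast; ring
    obtain ⟨h1, h2⟩ := sep i _ _ _ _ h'
    refine ⟨⟨m', ?_⟩, ⟨m, ?_⟩⟩
    · have : (k i : ℝ) = 2 * m' + 1 := by linarith
      exact_mod_cast this
    · have : (l i : ℝ) = 2 * m + 1 := by linarith
      exact_mod_cast this
  · rintro ⟨⟨m', hm'⟩, ⟨m, hm⟩⟩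
    refine ⟨m, m', ?_⟩
    rw [hm, hm']
    push_cast
    ring

end ThetaNull

/-! ### Two-division points on `Θ` -/

section TwoTorsion

variable {n : ℕ} (τ : Fin n → ℂ) (hΩ : ∀ i j, Matrix.diagonal τ i j = Matrix.diagonal τ j i)
  (hpos : (Matrix.of fun i j => (Matrix.diagonal τ i j).im).PosDef)
  (Φ : (Fin n ⊕ Fin n → ℝ) ≃L[ℝ] (Fin n → ℂ))
  (hΦ : ∀ v i, Φ v i = (v (Sum.inl i) : ℂ) + ∑ j, Matrix.diagonal τ i j * (v (Sum.inr j) : ℂ))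

/-- `m/2 ≡ ½ (mod ℤ)` iff `m` is odd. [folklore] -/
private theorem coe_half_intCast_eq_coe_half_iff (m : ℤ) :
    ((((m : ℝ) / 2 : ℝ)) : AddCircle (1 : ℝ)) = (((1 : ℝ) / 2 : ℝ) : AddCircle (1 : ℝ)) ↔ Odd m := by
  rw [← sub_eq_zero, ← AddCircle.coe_sub, AddCircle.coe_eq_zero_iff]
  constructor
  · rintro ⟨j, hj⟩
    rw [zsmul_eq_mul, mul_one] at hj
    refine ⟨j, ?_⟩
    have : (m : ℝ) = 2 * j + 1 := by linarith
    exact_mod_cast this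
  · rintro ⟨j, rfl⟩
    refine ⟨j, ?_⟩
    rw [zsmul_eq_mul, mul_one]
    push_cast
    ring

include hpos hΦ in
/-- **A two-division point of `E_{τ₁} × ⋯ × E_{τₙ}` lies on `Θ` iff some column of its `(ℤ/2ℤ)^{2n}`-image
is `(1, 1)`**: for `x ∈ X₂` with image `p = (p(inl i), p(inr i))ᵢ` under `X₂ ≃ (ℤ/2ℤ)^{2n}`,
`x ∈ Θ = ⋃ᵢ Dᵢ ↔ ∃ i, p(inl i) = p(inr i) = 1` (`x = π(½m)`, `x ∈ Dᵢ ↔ mᵢ, m_{n+i}` odd).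
[cite: Lange2023AbelianVarietiesComplex, §2.1.4 Exercise (7) (p0088) and §2.3.4 Prop. 2.3.14]
[cite: FarkasGrushevskySalvatimanni2021, §4 (arXiv p. 11)] -/
theorem coe_mem_thetaDivisor_diagonal_iff
    (x : (mapMatrixHom Φ Φ ((2 : ℤ) • (1 : Matrix (Fin n ⊕ Fin n) (Fin n ⊕ Fin n) ℤ))).ker) :
    (x : ComplexTorus Φ) ∈ thetaDivisor (Matrix.diagonal τ) hΩ hpos Φ hΦ ↔
      ∃ i, divisionPointsEquiv Φ two_ne_zero x (Sum.inl i) = 1 ∧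
        divisionPointsEquiv Φ two_ne_zero x (Sum.inr i) = 1 := by
  have h2 : (2 : ℤ) ≠ 0 := two_ne_zero
  obtain ⟨m, rfl⟩ := kerLatticeHomRestrict_surjective Φ Φ (det_smul_one_ne_zero h2) x
  have hcast : ∀ z : ℤ, ((z : ZMod (2 : ℤ).natAbs) = 1) ↔ Odd z := fun z ↦ ZMod.intCast_eq_one_iff_odd
  rw [divisionPointsEquiv_kerLatticeHomRestrict, coe_kerLatticeHomRestrict_smul_one Φ h2 m,
    thetaDivisor_diagonal_eq_iUnion τ hΩ hpos Φ hΦ, Set.mem_iUnion]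
  simp only [Set.mem_setOf_eq, proj_apply, Int.cast_ofNat, coe_half_intCast_eq_coe_half_iff, hcast]

/-- Counting columns: `#{p ∈ (ℤ/2ℤ)^{2n} ∣ ∃ i, (p(inl i), p(inr i)) = (1,1)} = 4ⁿ − 3ⁿ` (the complement has
`3` admissible values in each of the `n` columns). [folklore] -/
private theorem natCard_exists_column_eq_one (n : ℕ) :
    Nat.card {p : Fin n ⊕ Fin n → ZMod 2 // ∃ i, p (Sum.inl i) = 1 ∧ p (Sum.inr i) = 1} = 4 ^ n - 3 ^ n := by
  classical
  -- columns: `(ℤ/2)^{n ⊔ n} ≃ ((ℤ/2)²)ⁿ`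
  let e : (Fin n ⊕ Fin n → ZMod 2) ≃ (Fin n → ZMod 2 × ZMod 2) :=
    (Equiv.sumArrowEquivProdArrow (Fin n) (Fin n) (ZMod 2)).trans (Equiv.arrowProdEquivProdArrow _ _ _).symm
  have he : ∀ p i, e p i = (p (Sum.inl i), p (Sum.inr i)) := fun p i ↦ rfl
  -- the complement has `3` admissible values per column
  have hcompl : Fintype.card {p : Fin n ⊕ Fin n → ZMod 2 // ¬ ∃ i, p (Sum.inl i) = 1 ∧ p (Sum.inr i) = 1} =
      3 ^ n := by
    let f : {p : Fin n ⊕ Fin n → ZMod 2 // ¬ ∃ i, p (Sum.inl i) = 1 ∧ p (Sum.inr i) = 1} ≃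
        (Fin n → {q : ZMod 2 × ZMod 2 // ¬ (q.1 = 1 ∧ q.2 = 1)}) :=
      (e.subtypeEquiv (q := fun g : Fin n → ZMod 2 × ZMod 2 ↦ ∀ i, ¬ ((g i).1 = 1 ∧ (g i).2 = 1))
          (fun p ↦ by simp only [he, not_exists])).trans
        (Equiv.subtypePiEquivPi (β := fun _ : Fin n ↦ ZMod 2 × ZMod 2)
          (p := fun _ (q : ZMod 2 × ZMod 2) ↦ ¬ (q.1 = 1 ∧ q.2 = 1)))
    have h3 : Fintype.card {q : ZMod 2 × ZMod 2 // ¬ (q.1 = 1 ∧ q.2 = 1)} = 3 := by decide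
    rw [Fintype.card_congr f, Fintype.card_pi, Finset.prod_const, Finset.card_univ, Fintype.card_fin, h3]
  have htot : Fintype.card (Fin n ⊕ Fin n → ZMod 2) = 4 ^ n := by
    rw [Fintype.card_fun, ZMod.card, Fintype.card_sum, Fintype.card_fin, ← two_mul, pow_mul]
    norm_num
  have hc := Fintype.card_subtype_compl
    (fun p : Fin n ⊕ Fin n → ZMod 2 ↦ ∃ i, p (Sum.inl i) = 1 ∧ p (Sum.inr i) = 1)
  have hle := Fintype.card_subtype_le
    (fun p : Fin n ⊕ Fin n → ZMod 2 ↦ ∃ i, p (Sum.inl i) = 1 ∧ p (Sum.inr i) = 1)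
  rw [hcompl, htot] at hc
  rw [htot] at hle
  rw [Nat.card_eq_fintype_card]
  omega

include hpos hΦ in
/-- **`#(X₂ ∩ Θ) = 4ⁿ − 3ⁿ` for `E_{τ₁} × ⋯ × E_{τₙ}`**: the two-division points on the theta divisor of
a product of elliptic curves are those with a column `(1,1)` — all `2^{n-1}(2ⁿ − 1)` odd ones and
`4ⁿ − 3ⁿ − 2^{n-1}(2ⁿ − 1)` even ones (`A[2]^even ∩ Θ ≠ ∅` for `n ≥ 2`: the product lies on `θ_null`).
[cite: FarkasGrushevskySalvatimanni2021, §4 (arXiv p. 11)] [cite: Grushevsky2012SchottkyProblem, §5 (held p0011)] -/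
theorem natCard_twoTorsion_inter_thetaDivisor_diagonal :
    Nat.card {x : (mapMatrixHom Φ Φ ((2 : ℤ) • (1 : Matrix (Fin n ⊕ Fin n) (Fin n ⊕ Fin n) ℤ))).ker //
        (x : ComplexTorus Φ) ∈ thetaDivisor (Matrix.diagonal τ) hΩ hpos Φ hΦ} = 4 ^ n - 3 ^ n := by
  rw [Nat.card_congr ((divisionPointsEquiv Φ (two_ne_zero (α := ℤ))).toEquiv.subtypeEquiv
    (q := fun p ↦ ∃ i, p (Sum.inl i) = 1 ∧ p (Sum.inr i) = 1)
    (fun x ↦ coe_mem_thetaDivisor_diagonal_iff τ hΩ hpos Φ hΦ x)),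
    show (2 : ℤ).natAbs = 2 from rfl]
  exact natCard_exists_column_eq_one n

/-- **`E_{τ₁} × E_{τ₂}`: exactly `7` of the `16` two-division points lie on `Θ`** (`4² − 3² = 7`: the
`6` odd ones and the even node `(p₁, p₂)`). [cite: FarkasGrushevskySalvatimanni2021, §4 (arXiv p. 11)] -/
theorem natCard_twoTorsion_inter_thetaDivisor_diagonal_fin_two (τ : Fin 2 → ℂ)
    (hΩ : ∀ i j, Matrix.diagonal τ i j = Matrix.diagonal τ j i)
    (hpos : (Matrix.of fun i j => (Matrix.diagonal τ i j).im).PosDef)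
    (Φ : (Fin 2 ⊕ Fin 2 → ℝ) ≃L[ℝ] (Fin 2 → ℂ))
    (hΦ : ∀ v i, Φ v i = (v (Sum.inl i) : ℂ) + ∑ j, Matrix.diagonal τ i j * (v (Sum.inr j) : ℂ)) :
    Nat.card {x : (mapMatrixHom Φ Φ ((2 : ℤ) • (1 : Matrix (Fin 2 ⊕ Fin 2) (Fin 2 ⊕ Fin 2) ℤ))).ker //
        (x : ComplexTorus Φ) ∈ thetaDivisor (Matrix.diagonal τ) hΩ hpos Φ hΦ} = 7 := by
  rw [natCard_twoTorsion_inter_thetaDivisor_diagonal τ hΩ hpos Φ hΦ]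
  norm_num

include hpos hΦ in
/-- **More than the odd ones for `n ≥ 2`**: `2^{n-1}(2ⁿ − 1) < #(X₂ ∩ Θ) = 4ⁿ − 3ⁿ` for a product of
`n ≥ 2` elliptic curves — the EVEN two-division points with at least two odd columns lie on `Θ`
(`𝒜_g^dec ⊂ θ_null,g`). [cite: Grushevsky2012SchottkyProblem, §5 (held p0011)]
[cite: FarkasGrushevskySalvatimanni2021, §4 (arXiv p. 11)] -/
theorem natCard_twoTorsion_odd_lt_of_two_le (hn : 2 ≤ n) :
    2 ^ (n - 1) * (2 ^ n - 1) <
      Nat.card {x : (mapMatrixHom Φ Φ ((2 : ℤ) • (1 : Matrix (Fin n ⊕ Fin n) (Fin n ⊕ Fin n) ℤ))).ker //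
        (x : ComplexTorus Φ) ∈ thetaDivisor (Matrix.diagonal τ) hΩ hpos Φ hΦ} := by
  rw [natCard_twoTorsion_inter_thetaDivisor_diagonal τ hΩ hpos Φ hΦ]
  -- `3^{j+2} < 2a² + a` with `a = 2^{j+1}`, by induction on `j`
  have key : ∀ j : ℕ, 3 ^ (j + 2) < 2 * (2 ^ (j + 1)) ^ 2 + 2 ^ (j + 1) := by
    intro j
    induction j with
    | zero => norm_num
    | succ j ih =>
      have ha : 1 ≤ 2 ^ (j + 1) := Nat.one_le_two_pow
      rw [show j + 1 + 2 = (j + 2) + 1 from rfl, pow_succ, show j + 1 + 1 = (j + 1) + 1 from rfl,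
        pow_succ 2 (j + 1)]
      nlinarith [ih, ha]
  obtain ⟨j, rfl⟩ : ∃ j, n = j + 2 := ⟨n - 2, by omega⟩
  have h3 := key j
  have ha1 : 1 ≤ 2 ^ (j + 1) := Nat.one_le_two_pow
  have h2n : 2 ^ (j + 2) = 2 * 2 ^ (j + 1) := by rw [pow_succ]; ring
  have h4n : 4 ^ (j + 2) = 4 * (2 ^ (j + 1)) ^ 2 := by
    rw [show (4 : ℕ) = 2 ^ 2 by norm_num, ← pow_mul]
    rw [show 2 * (j + 2) = 2 + (j + 1) + (j + 1) by ring, pow_add, pow_add]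
    ring
  rw [show j + 2 - 1 = j + 1 by omega, h2n, h4n]
  have hlt : 3 ^ (j + 2) ≤ 4 * (2 ^ (j + 1)) ^ 2 := by nlinarith
  zify [ha1, hlt, show 1 ≤ 2 * 2 ^ (j + 1) by omega]
  zify at h3
  nlinarith [h3]

end TwoTorsion

end ComplexTorus

end Literature.Geometry.Kaehler

end
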